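import Summits.QuantumAdvantage.QuantumAdvantage.Theorems.CubicForrelationNearExactIsExactTwelvePartnerLight
import Summits.QuantumAdvantage.QuantumAdvantage.Theorems.CubicForrelationNearExactIsExactCubicFormR2PartnerCells
import Summits.QuantumAdvantage.QuantumAdvantage.Theorems.CubicForrelationNearExactIsExactCubicFormR2PartnerWlog
import Summits.QuantumAdvantage.QuantumAdvantage.Theorems.CubicForrelationNearExactIsExactCubicFormR2Partner
import Summits.QuantumAdvantage.QuantumAdvantage.Theorems.CubicForrelationNearExactIsExactCubicFormLightStructureT
import Summits.QuantumAdvantage.QuantumAdvantage.Theorems.CubicForrelationNearExactIsExactCubicFormLightRows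
import Summits.QuantumAdvantage.QuantumAdvantage.Theorems.CubicForrelationNearExactIsExactTwelvePartnerR2LeafTa
import Summits.QuantumAdvantage.QuantumAdvantage.Theorems.CubicForrelationNearExactIsExactTwelvePartnerR2LeafTb

/-!
# Crux `CubicForrelation.NearExactIsExact` (stmt-QuantumAdvantage-14043) — E1280-even, R2 branch: LEVEL `h = 1` (descendant `T = s₀s₁s₂`,
  light cell of weight `64`) END-TO-END

Certificate seat `b2b-cforr-cert` (gen 42).  HONEST FRAMING: kernel-checked assembly (standard axioms) of the `T` endgame of R2-PARTNER §4(T) /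
E1280-HANDPROOFS §1.1–1.2 (rank count; block algebra + symplectic pairing parity): the light cell `C₀₀` (weight `64`, cubic form `s₀s₁s₂`;
hypotheses of `H1` in …CubicFormR2LowAssembly); WLOG `w(C₁₀) ≤ w(C₀₁)` by the swap `y₁ ↔ y₂` (`tpw_R2_yframe_transport`); the cells'
unit second-difference matrices (`tlt_T_cell_matrix`, `tlt_light_structure`: cell lemma L-T); if `w(C₀₁) < 192` the `F`-rows of `G` have rank
`≤ 1` and those of `Γ` rank `≤ 2` — leaf `tpa_R2_Tb`; else `w(C₁₀) < 128`, the `F`-rows of `G` vanish — leaf `tpa_R2_Ta`.  It discharges the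
hypothesis `H1` of `theta_twelve_eq_57_64_of_low`.  NOT summit progress.

* `tpw_R2_level_one_ordered` (the case `w(C₁₀) ≤ w(C₀₁)`), `tpw_R2_level_one` (`H1`).

References: this seat lineage (g37 R2-PARTNER §4(T), g39 HANDPROOFS §1.1–1.2 + leaves `tpa_R2_Ta/Tb`, g41 cell lemma L-T).  Axioms: the
standard three.
-/

set_option linter.dupNamespace false -- D-0017: single-problem summit ⇒ `QuantumAdvantage.QuantumAdvantage` by design

namespace Summit.QuantumAdvantage.QuantumAdvantage.Theorems.CubicForrelation.NearExactIsExact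

open Finset
open Literature.Computability.QuantumComplexity
open Literature.Computability.QuantumComplexity.BuzetChailloux (bxor zeroVec bxor_comm bxor_self bxor_zeroVec zeroVec_bxor
  bxor_bxor_cancel_left)

/-- **Level `h = 1` (`T`), light cell `C₀₀`, ordered neighbours `w(C₁₀) ≤ w(C₀₁)`.** [this work] -/
theorem tpw_R2_level_one_ordered (hk : 1 + 1 + 1 ≤ 9) (κ : (Fin (3 + 9) → Bool) → Bool) (hκ : IsDegLeFun 3 κ)
    (c d : Fin (3 + 9) → Fin (3 + 9) → Fin (3 + 9) → ZMod 2)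
    (hcs : ∀ p j k, c p k j = c p j k) (hcc : ∀ p j k, c j p k = c p j k) (hcd : ∀ p j, c p j j = 0)
    (hds : ∀ φ j k, d φ k j = d φ j k) (hdc : ∀ φ j k, d j φ k = d φ j k) (hdd : ∀ φ j, d φ j j = 0)
    (hd : ∀ φ j k, d φ j k =
      if ((((κ zeroVec ^^ κ (bxor zeroVec (fun l => decide (l = k)))) ^^
            (κ (bxor zeroVec (fun l => decide (l = j))) ^^ κ (bxor (bxor zeroVec (fun l => decide (l = j))) (fun l => decide (l = k))))) ^^
          ((κ (bxor zeroVec (fun l => decide (l = φ))) ^^ κ (bxor (bxor zeroVec (fun l => decide (l = φ))) (fun l => decide (l = k)))) ^^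
            (κ (bxor (bxor zeroVec (fun l => decide (l = φ))) (fun l => decide (l = j))) ^^
              κ (bxor (bxor (bxor zeroVec (fun l => decide (l = φ))) (fun l => decide (l = j))) (fun l => decide (l = k))))))) = true
      then 1 else 0)
    (hpair : ∀ p φ, (∑ j, ∑ k, (if j < k then c p j k * d φ j k else 0)) = if p = φ then 1 else 0)
    (hD0 : ∀ y, (κ y ^^ κ (bxor y (fun l => decide (l = Fin.castAdd 9 (0 : Fin 3))))) =
      (y (Fin.castAdd 9 (1 : Fin 3)) && y (Fin.castAdd 9 (2 : Fin 3))))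
    (hF1 : ∀ j k, d (Fin.castAdd 9 0) j k =
      if (j = Fin.castAdd 9 1 ∧ k = Fin.castAdd 9 2) ∨ (j = Fin.castAdd 9 2 ∧ k = Fin.castAdd 9 1) then 1 else 0)
    (hsum : #(univ.filter fun s : Fin 9 → Bool => κ (Fin.append ![false, false, false] s) = true) +
      #(univ.filter fun s : Fin 9 → Bool => κ (Fin.append ![false, false, true] s) = true) +
      #(univ.filter fun s : Fin 9 → Bool => κ (Fin.append ![false, true, false] s) = true) < 384)
    (hwt : 4 * #(univ.filter fun s : Fin 9 → Bool => κ (Fin.append ![false, false, false] s) = true) + 2 ^ (9 - 1) = 2 ^ 9)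
    (hT : ∀ u v w x : Fin 9 → Bool,
      ((((κ (Fin.append ![false, false, false] x) ^^ κ (Fin.append ![false, false, false] (bxor x w))) ^^
              (κ (Fin.append ![false, false, false] (bxor x v)) ^^ κ (Fin.append ![false, false, false] (bxor (bxor x v) w)))) ^^
            ((κ (Fin.append ![false, false, false] (bxor x u)) ^^ κ (Fin.append ![false, false, false] (bxor (bxor x u) w))) ^^
              (κ (Fin.append ![false, false, false] (bxor (bxor x u) v)) ^^
                κ (Fin.append ![false, false, false] (bxor (bxor (bxor x u) v) w)))))) =
      ((((u (Fin.castLE hk (Fin.castAdd 1 (Fin.castAdd 1 (0 : Fin 1)))) &&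
            decide ((∑ ii : Fin 1, ((if v (Fin.castLE hk (Fin.castAdd 1 (Fin.natAdd 1 ii))) = true then (1 : ZMod 2) else 0) * (if w (Fin.castLE hk (Fin.natAdd (1 + 1) ii)) = true then (1 : ZMod 2) else 0) +
              (if v (Fin.castLE hk (Fin.natAdd (1 + 1) ii)) = true then (1 : ZMod 2) else 0) * (if w (Fin.castLE hk (Fin.castAdd 1 (Fin.natAdd 1 ii))) = true then (1 : ZMod 2) else 0))) = 1)) ^^
          (v (Fin.castLE hk (Fin.castAdd 1 (Fin.castAdd 1 (0 : Fin 1)))) &&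
            decide ((∑ ii : Fin 1, ((if u (Fin.castLE hk (Fin.castAdd 1 (Fin.natAdd 1 ii))) = true then (1 : ZMod 2) else 0) * (if w (Fin.castLE hk (Fin.natAdd (1 + 1) ii)) = true then (1 : ZMod 2) else 0) +
              (if u (Fin.castLE hk (Fin.natAdd (1 + 1) ii)) = true then (1 : ZMod 2) else 0) * (if w (Fin.castLE hk (Fin.castAdd 1 (Fin.natAdd 1 ii))) = true then (1 : ZMod 2) else 0))) = 1))) ^^
          (w (Fin.castLE hk (Fin.castAdd 1 (Fin.castAdd 1 (0 : Fin 1)))) &&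
            decide ((∑ ii : Fin 1, ((if u (Fin.castLE hk (Fin.castAdd 1 (Fin.natAdd 1 ii))) = true then (1 : ZMod 2) else 0) * (if v (Fin.castLE hk (Fin.natAdd (1 + 1) ii)) = true then (1 : ZMod 2) else 0) +
              (if u (Fin.castLE hk (Fin.natAdd (1 + 1) ii)) = true then (1 : ZMod 2) else 0) * (if v (Fin.castLE hk (Fin.castAdd 1 (Fin.natAdd 1 ii))) = true then (1 : ZMod 2) else 0))) = 1)))))
    (hle : #(univ.filter fun s : Fin 9 → Bool => κ (Fin.append ![false, true, false] s) = true) ≤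
      #(univ.filter fun s : Fin 9 → Bool => κ (Fin.append ![false, false, true] s) = true)) : False := by
  obtain ⟨-, htb, -⟩ := tpw_R2_cells κ hκ d hd hD0
  have hW0 : #(univ.filter fun s : Fin 9 → Bool => κ (Fin.append ![false, false, false] s) = true) = 64 := by
    norm_num at hwt; omega
  have hw10 : #(univ.filter fun s : Fin 9 → Bool => κ (Fin.append ![false, true, false] s) = true) < 160 := by omega
  -- the light cell's third differences in the `T` format on `Fin (3 + 6)`
  have i0 : (Fin.castLE hk (Fin.castAdd 1 (Fin.castAdd 1 (0 : Fin 1))) : Fin 9) = Fin.castAdd 6 (0 : Fin 3) := Fin.ext (by simp)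
  have i1 : (Fin.castLE hk (Fin.castAdd 1 (Fin.natAdd 1 (0 : Fin 1))) : Fin 9) = Fin.castAdd 6 (1 : Fin 3) := Fin.ext (by simp)
  have i2 : (Fin.castLE hk (Fin.natAdd (1 + 1) (0 : Fin 1)) : Fin 9) = Fin.castAdd 6 (2 : Fin 3) := Fin.ext (by simp)
  have hB : ∀ a b c e' : Bool, decide ((if a = true then (1 : ZMod 2) else 0) * (if b = true then (1 : ZMod 2) else 0) +
      (if c = true then (1 : ZMod 2) else 0) * (if e' = true then (1 : ZMod 2) else 0) = 1) = ((a && b) ^^ (c && e')) := by decide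
  have hperm : ∀ u0 u1 u2 v0 v1 v2 w0 w1 w2 : Bool,
      (((u0 && ((v1 && w2) ^^ (v2 && w1))) ^^ (v0 && ((u1 && w2) ^^ (u2 && w1)))) ^^ (w0 && ((u1 && v2) ^^ (u2 && v1)))) =
      ((((u0 && (v1 && w2)) ^^ (u0 && (v2 && w1))) ^^ ((u1 && (v0 && w2)) ^^ (u1 && (v2 && w0)))) ^^
        ((u2 && (v0 && w1)) ^^ (u2 && (v1 && w0)))) := by decide
  have hTT : ∀ u v w x : Fin (3 + 6) → Bool,
      ((((κ (Fin.append ![false, false, false] x) ^^ κ (Fin.append ![false, false, false] (bxor x w))) ^^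
            (κ (Fin.append ![false, false, false] (bxor x v)) ^^ κ (Fin.append ![false, false, false] (bxor (bxor x v) w)))) ^^
          ((κ (Fin.append ![false, false, false] (bxor x u)) ^^ κ (Fin.append ![false, false, false] (bxor (bxor x u) w))) ^^
            (κ (Fin.append ![false, false, false] (bxor (bxor x u) v)) ^^
              κ (Fin.append ![false, false, false] (bxor (bxor (bxor x u) v) w)))))) =
      ((((u (Fin.castAdd 6 0) && (v (Fin.castAdd 6 1) && w (Fin.castAdd 6 2))) ^^
              (u (Fin.castAdd 6 0) && (v (Fin.castAdd 6 2) && w (Fin.castAdd 6 1)))) ^^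
            ((u (Fin.castAdd 6 1) && (v (Fin.castAdd 6 0) && w (Fin.castAdd 6 2))) ^^
              (u (Fin.castAdd 6 1) && (v (Fin.castAdd 6 2) && w (Fin.castAdd 6 0))))) ^^
          ((u (Fin.castAdd 6 2) && (v (Fin.castAdd 6 0) && w (Fin.castAdd 6 1))) ^^
            (u (Fin.castAdd 6 2) && (v (Fin.castAdd 6 1) && w (Fin.castAdd 6 0))))) := by
    intro u v w x
    rw [hT u v w x]
    simp only [Fin.sum_univ_one, i0, i1, i2, hB]
    exact hperm _ _ _ _ _ _ _ _ _
  -- every cell has the same third differences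
  have hTv : ∀ (vv : Fin 3 → Bool) (u v w x : Fin (3 + 6) → Bool),
      ((((κ (Fin.append vv x) ^^ κ (Fin.append vv (bxor x w))) ^^
            (κ (Fin.append vv (bxor x v)) ^^ κ (Fin.append vv (bxor (bxor x v) w)))) ^^
          ((κ (Fin.append vv (bxor x u)) ^^ κ (Fin.append vv (bxor (bxor x u) w))) ^^
            (κ (Fin.append vv (bxor (bxor x u) v)) ^^
              κ (Fin.append vv (bxor (bxor (bxor x u) v) w)))))) =
      ((((u (Fin.castAdd 6 0) && (v (Fin.castAdd 6 1) && w (Fin.castAdd 6 2))) ^^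
              (u (Fin.castAdd 6 0) && (v (Fin.castAdd 6 2) && w (Fin.castAdd 6 1)))) ^^
            ((u (Fin.castAdd 6 1) && (v (Fin.castAdd 6 0) && w (Fin.castAdd 6 2))) ^^
              (u (Fin.castAdd 6 1) && (v (Fin.castAdd 6 2) && w (Fin.castAdd 6 0))))) ^^
          ((u (Fin.castAdd 6 2) && (v (Fin.castAdd 6 0) && w (Fin.castAdd 6 1))) ^^
            (u (Fin.castAdd 6 2) && (v (Fin.castAdd 6 1) && w (Fin.castAdd 6 0))))) := by
    intro vv u v w x
    have h1 := tcc_third_rho κ vv u v w x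
    have h2 := tcc_third_rho κ ![false, false, false] u v w x
    dsimp only at h1 h2
    rw [h1, tcf_third_const κ hκ _ _ _ (Fin.append vv x) (Fin.append ![false, false, false] x), ← h2]
    exact hTT u v w x
  -- the `S`-block of `d` from the `T` formula
  have hvan : ∀ f : Fin 6, decide (Fin.castAdd 6 (0 : Fin 3) = Fin.natAdd 3 f) = false ∧
      decide (Fin.castAdd 6 (1 : Fin 3) = Fin.natAdd 3 f) = false ∧ decide (Fin.castAdd 6 (2 : Fin 3) = Fin.natAdd 3 f) = false := by
    decide
  have htbF : ∀ (f : Fin 6) (s t : Fin (3 + 6)), d (Fin.natAdd 3 (Fin.natAdd 3 f)) (Fin.natAdd 3 s) (Fin.natAdd 3 t) = 0 := by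
    intro f s t
    rw [htb ![false, false, false] (Fin.natAdd 3 f) s t zeroVec, hTv]
    obtain ⟨q0, q1, q2⟩ := hvan f
    simp only [q0, q1, q2, Bool.false_and, Bool.xor_false]
    exact if_neg Bool.false_ne_true
  have c00 : decide (Fin.castAdd 6 (0 : Fin 3) = Fin.castAdd 6 (0 : Fin 3)) = true := by decide
  have c10 : decide (Fin.castAdd 6 (1 : Fin 3) = Fin.castAdd 6 (0 : Fin 3)) = false := by decide
  have c20 : decide (Fin.castAdd 6 (2 : Fin 3) = Fin.castAdd 6 (0 : Fin 3)) = false := by decide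
  have c01 : decide (Fin.castAdd 6 (0 : Fin 3) = Fin.castAdd 6 (1 : Fin 3)) = false := by decide
  have c11 : decide (Fin.castAdd 6 (1 : Fin 3) = Fin.castAdd 6 (1 : Fin 3)) = true := by decide
  have c21 : decide (Fin.castAdd 6 (2 : Fin 3) = Fin.castAdd 6 (1 : Fin 3)) = false := by decide
  have c02 : decide (Fin.castAdd 6 (0 : Fin 3) = Fin.castAdd 6 (2 : Fin 3)) = false := by decide
  have c12 : decide (Fin.castAdd 6 (1 : Fin 3) = Fin.castAdd 6 (2 : Fin 3)) = false := by decide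
  have c22 : decide (Fin.castAdd 6 (2 : Fin 3) = Fin.castAdd 6 (2 : Fin 3)) = true := by decide
  have L0 : ∀ v0 v1 v2 w0 w1 w2 : Bool,
      ((((true && (v1 && w2)) ^^ (true && (v2 && w1))) ^^ ((false && (v0 && w2)) ^^ (false && (v2 && w0)))) ^^
        ((false && (v0 && w1)) ^^ (false && (v1 && w0)))) = ((v1 && w2) ^^ (v2 && w1)) := by decide
  have L1 : ∀ v0 v1 v2 w0 w1 w2 : Bool,
      ((((false && (v1 && w2)) ^^ (false && (v2 && w1))) ^^ ((true && (v0 && w2)) ^^ (true && (v2 && w0)))) ^^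
        ((false && (v0 && w1)) ^^ (false && (v1 && w0)))) = ((v0 && w2) ^^ (v2 && w0)) := by decide
  have L2 : ∀ v0 v1 v2 w0 w1 w2 : Bool,
      ((((false && (v1 && w2)) ^^ (false && (v2 && w1))) ^^ ((false && (v0 && w2)) ^^ (false && (v2 && w0)))) ^^
        ((true && (v0 && w1)) ^^ (true && (v1 && w0)))) = ((v0 && w1) ^^ (v1 && w0)) := by decide
  -- the slices of `t̄` at the three `U`-coordinates
  have hfin : ∀ (b b' : Fin 3), b ≠ b' → ∀ s t : Fin (3 + 6),
      ((if ((decide (Fin.castAdd 6 b = s) && decide (Fin.castAdd 6 b' = t)) ^^ (decide (Fin.castAdd 6 b' = s) && decide (Fin.castAdd 6 b = t))) = true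
        then (1 : ZMod 2) else 0) =
      if (s = Fin.castAdd 6 b ∧ t = Fin.castAdd 6 b') ∨ (s = Fin.castAdd 6 b' ∧ t = Fin.castAdd 6 b) then 1 else 0) := by
    intro b b' hbb' s t
    have hAC : (decide (Fin.castAdd 6 b = s) && decide (Fin.castAdd 6 b' = s)) = false := by
      by_cases h1 : Fin.castAdd 6 b = s
      · have : ¬ Fin.castAdd 6 b' = s := fun h2 => hbb' (Fin.castAdd_inj.mp (h1.trans h2.symm))
        simp [this]
      · simp [h1]
    rw [tpw_key_F1 _ _ _ _ hAC]
    simp only [decide_eq_true_eq]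
    have hiff : ((Fin.castAdd 6 b = s ∧ Fin.castAdd 6 b' = t) ∨ (Fin.castAdd 6 b' = s ∧ Fin.castAdd 6 b = t)) ↔
        ((s = Fin.castAdd 6 b ∧ t = Fin.castAdd 6 b') ∨ (s = Fin.castAdd 6 b' ∧ t = Fin.castAdd 6 b)) := by
      constructor
      · rintro (⟨h1, h2⟩ | ⟨h1, h2⟩)
        · exact Or.inl ⟨h1.symm, h2.symm⟩
        · exact Or.inr ⟨h1.symm, h2.symm⟩
      · rintro (⟨h1, h2⟩ | ⟨h1, h2⟩)
        · exact Or.inl ⟨h1.symm, h2.symm⟩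
        · exact Or.inr ⟨h1.symm, h2.symm⟩
    simp only [hiff]
  have htb0 : ∀ s t : Fin (3 + 6), d (Fin.natAdd 3 (Fin.castAdd 6 0)) (Fin.natAdd 3 s) (Fin.natAdd 3 t) =
      if (s = Fin.castAdd 6 1 ∧ t = Fin.castAdd 6 2) ∨ (s = Fin.castAdd 6 2 ∧ t = Fin.castAdd 6 1) then 1 else 0 := by
    intro s t
    rw [htb ![false, false, false] (Fin.castAdd 6 0) s t zeroVec, hTv]
    rw [c00, c10, c20, L0]
    exact hfin 1 2 (by decide) s t
  have htb1 : ∀ s t : Fin (3 + 6), d (Fin.natAdd 3 (Fin.castAdd 6 1)) (Fin.natAdd 3 s) (Fin.natAdd 3 t) =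
      if (s = Fin.castAdd 6 0 ∧ t = Fin.castAdd 6 2) ∨ (s = Fin.castAdd 6 2 ∧ t = Fin.castAdd 6 0) then 1 else 0 := by
    intro s t
    rw [htb ![false, false, false] (Fin.castAdd 6 1) s t zeroVec, hTv]
    rw [c01, c11, c21, L1]
    exact hfin 0 2 (by decide) s t
  have htb2 : ∀ s t : Fin (3 + 6), d (Fin.natAdd 3 (Fin.castAdd 6 2)) (Fin.natAdd 3 s) (Fin.natAdd 3 t) =
      if (s = Fin.castAdd 6 0 ∧ t = Fin.castAdd 6 1) ∨ (s = Fin.castAdd 6 1 ∧ t = Fin.castAdd 6 0) then 1 else 0 := by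
    intro s t
    rw [htb ![false, false, false] (Fin.castAdd 6 2) s t zeroVec, hTv]
    rw [c02, c12, c22, L2]
    exact hfin 0 1 (by decide) s t
  -- mixed slices in terms of `d`
  have hv0 : Fin.append ![false, false, false] (zeroVec : Fin (3 + 6) → Bool) = (zeroVec : Fin (3 + (3 + 6)) → Bool) := by
    funext l
    refine Fin.addCases (fun t => ?_) (fun σ => ?_) l
    · rw [Fin.append_left]; fin_cases t <;> rfl
    · rw [Fin.append_right]; rfl
  have hmixd : ∀ (t : Fin 3) (jj kk : Fin (3 + 6)) (val : Bool),
      ((((κ (Fin.append ![false, false, false] zeroVec) ^^ κ (bxor (Fin.append ![false, false, false] zeroVec) (fun l => decide (l = Fin.natAdd 3 kk)))) ^^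
              (κ (bxor (Fin.append ![false, false, false] zeroVec) (fun l => decide (l = Fin.natAdd 3 jj))) ^^ κ (bxor (bxor (Fin.append ![false, false, false] zeroVec) (fun l => decide (l = Fin.natAdd 3 jj))) (fun l => decide (l = Fin.natAdd 3 kk))))) ^^
            ((κ (bxor (Fin.append ![false, false, false] zeroVec) (fun l => decide (l = Fin.castAdd (3 + 6) t))) ^^ κ (bxor (bxor (Fin.append ![false, false, false] zeroVec) (fun l => decide (l = Fin.castAdd (3 + 6) t))) (fun l => decide (l = Fin.natAdd 3 kk)))) ^^
              (κ (bxor (bxor (Fin.append ![false, false, false] zeroVec) (fun l => decide (l = Fin.castAdd (3 + 6) t))) (fun l => decide (l = Fin.natAdd 3 jj))) ^^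
                κ (bxor (bxor (bxor (Fin.append ![false, false, false] zeroVec) (fun l => decide (l = Fin.castAdd (3 + 6) t))) (fun l => decide (l = Fin.natAdd 3 jj))) (fun l => decide (l = Fin.natAdd 3 kk))))))) = val →
      d (Fin.castAdd (3 + 6) t) (Fin.natAdd 3 jj) (Fin.natAdd 3 kk) = if val = true then 1 else 0 := by
    intro t jj kk val e
    rw [hv0] at e
    rw [hd]
    exact congrArg (fun b : Bool => if b = true then (1 : ZMod 2) else 0) e
  have hb1 : bxor ![false, false, false] (fun l => decide (l = (1 : Fin 3))) = ![false, true, false] := by decide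
  have hb2 : bxor ![false, false, false] (fun l => decide (l = (2 : Fin 3))) = ![false, false, true] := by decide
  have h128 : #(univ.filter fun y : Fin (3 + 6) → Bool => κ (Fin.append ![false, false, false] y) = true) < 128 := by
    show #(univ.filter fun s : Fin 9 → Bool => κ (Fin.append ![false, false, false] s) = true) < 128; omega
  have hand : ∀ a b : Bool, (if (a && b) = true then (1 : ZMod 2) else 0) = (if a = true then 1 else 0) * (if b = true then 1 else 0) := by decide
  have hxor2 : ∀ a b c e' : Bool, (if ((a && b) ^^ (c && e')) = true then (1 : ZMod 2) else 0) =
      (if a = true then 1 else 0) * (if b = true then 1 else 0) + (if c = true then 1 else 0) * (if e' = true then 1 else 0) := by decide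
  by_cases h192 : #(univ.filter fun s : Fin 9 → Bool => κ (Fin.append ![false, false, true] s) = true) < 192
  · -- both mixed slices are structured: leaf `Tb`
    have h160' : #(univ.filter fun y : Fin (3 + 6) → Bool =>
        κ (Fin.append (bxor ![false, false, false] (fun l => decide (l = (1 : Fin 3)))) y) = true) < 160 := by
      rw [hb1]; exact hw10
    have h192' : #(univ.filter fun y : Fin (3 + 6) → Bool =>
        κ (Fin.append (bxor ![false, false, false] (fun l => decide (l = (2 : Fin 3)))) y) = true) < 192 := by
      rw [hb2]; exact h192
    have L1 := tlt_light_structure κ hκ ![false, false, false] hTT 1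
    have L2 := tlt_light_structure κ hκ ![false, false, false] hTT 2
    dsimp only at L1 L2
    obtain ⟨g, ν, hg⟩ := L1.1 h128 h160'
    rcases L2.2 h128 h192' with ⟨m, μ, hm⟩ | ⟨m, m', μ, μ', hm⟩
    · refine tpa_R2_Tb c d hcs hcc hds hdc hdd hpair hF1 htbF (fun f => if g f = true then 1 else 0) (fun f => if m f = true then 1 else 0)
        (fun _ => 0) (fun s => if ν s = true then 1 else 0) (fun s => if μ s = true then 1 else 0) (fun _ => 0) ?_ ?_
      · intro f s; rw [hmixd 1 _ _ _ (hg f s), hand]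
      · intro f s; rw [hmixd 2 _ _ _ (hm f s), hand]; ring
    · refine tpa_R2_Tb c d hcs hcc hds hdc hdd hpair hF1 htbF (fun f => if g f = true then 1 else 0) (fun f => if m f = true then 1 else 0)
        (fun f => if m' f = true then 1 else 0) (fun s => if ν s = true then 1 else 0) (fun s => if μ s = true then 1 else 0)
        (fun s => if μ' s = true then 1 else 0) ?_ ?_
      · intro f s; rw [hmixd 1 _ _ _ (hg f s), hand]
      · intro f s; rw [hmixd 2 _ _ _ (hm f s), hxor2]
  · -- `w(C₀₁) ≥ 192`: then `w(C₁₀) < 128`, the `F`-rows of `G` vanish: leaf `Ta`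
    have hw10' : #(univ.filter fun y : Fin (3 + 6) → Bool => κ (Fin.append ![false, true, false] y) = true) < 128 := by
      show #(univ.filter fun s : Fin 9 → Bool => κ (Fin.append ![false, true, false] s) = true) < 128; omega
    have M0 := (tlt_T_cell_matrix (fun s : Fin (3 + 6) → Bool => κ (Fin.append ![false, false, false] s)) hTT).2.1 h128
    have M1 := (tlt_T_cell_matrix (fun s : Fin (3 + 6) → Bool => κ (Fin.append ![false, true, false] s)) (hTv _)).2.1 hw10'
    dsimp only at M0 M1
    have hG : ∀ (f : Fin 6) (s : Fin (3 + 6)), d (Fin.castAdd 9 1) (Fin.natAdd 3 (Fin.natAdd 3 f)) (Fin.natAdd 3 s) = 0 := by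
      intro f s
      have e0 := M0 f s
      have e1 := M1 f s
      refine (hmixd 1 (Fin.natAdd 3 f) s false ?_).trans (if_neg Bool.false_ne_true)
      rw [tcc_unit_left (1 : Fin 3), tcc_unit_right (Fin.natAdd 3 f), tcc_unit_right s]
      simp only [tcc_append_bxor, bxor_zeroVec, zeroVec_bxor, hb1]
      revert e0 e1
      generalize κ (Fin.append ![false, false, false] zeroVec) = a₁
      generalize κ (Fin.append ![false, false, false] (fun l => decide (l = s))) = a₂
      generalize κ (Fin.append ![false, false, false] (fun l => decide (l = Fin.natAdd 3 f))) = a₃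
      generalize κ (Fin.append ![false, false, false] (bxor (fun l => decide (l = Fin.natAdd 3 f)) (fun l => decide (l = s)))) = a₄
      generalize κ (Fin.append ![false, true, false] zeroVec) = a₅
      generalize κ (Fin.append ![false, true, false] (fun l => decide (l = s))) = a₆
      generalize κ (Fin.append ![false, true, false] (fun l => decide (l = Fin.natAdd 3 f))) = a₇
      generalize κ (Fin.append ![false, true, false] (bxor (fun l => decide (l = Fin.natAdd 3 f)) (fun l => decide (l = s)))) = a₈
      generalize (((zeroVec : Fin (3 + 6) → Bool) (Fin.castAdd 6 0) && (zeroVec : Fin (3 + 6) → Bool) (Fin.castAdd 6 1)) &&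
        (zeroVec : Fin (3 + 6) → Bool) (Fin.castAdd 6 2)) = n₁
      generalize (((fun l => decide (l = s)) (Fin.castAdd 6 0) && (fun l => decide (l = s)) (Fin.castAdd 6 1)) &&
        (fun l => decide (l = s)) (Fin.castAdd 6 2)) = n₂
      generalize (((fun l => decide (l = Fin.natAdd 3 f)) (Fin.castAdd 6 0) && (fun l => decide (l = Fin.natAdd 3 f)) (Fin.castAdd 6 1)) &&
        (fun l => decide (l = Fin.natAdd 3 f)) (Fin.castAdd 6 2)) = n₃
      generalize (((bxor (fun l => decide (l = Fin.natAdd 3 f)) (fun l => decide (l = s))) (Fin.castAdd 6 0) &&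
        (bxor (fun l => decide (l = Fin.natAdd 3 f)) (fun l => decide (l = s))) (Fin.castAdd 6 1)) &&
        (bxor (fun l => decide (l = Fin.natAdd 3 f)) (fun l => decide (l = s))) (Fin.castAdd 6 2)) = n₄
      intro e0 e1
      revert a₁ a₂ a₃ a₄ a₅ a₆ a₇ a₈ n₁ n₂ n₃ n₄
      decide
    exact tpa_R2_Ta c d hcs hcc hcd hds hdc hdd hpair hF1 htbF htb0 htb1 htb2 hG

/-- **Level `h = 1` (`T`) of the R2 branch, light cell `C₀₀`** — the hypothesis `H1` of `theta_twelve_eq_57_64_of_low`: reduce to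
`w(C₁₀) ≤ w(C₀₁)` by the swap `y₁ ↔ y₂` (`tpw_R2_yframe_transport`), then `tpw_R2_level_one_ordered`. [this work] -/
theorem tpw_R2_level_one :
    ∀ (hk : 1 + 1 + 1 ≤ 9), 1 ≤ 1 →
    ∀ (κ : (Fin (3 + 9) → Bool) → Bool), IsDegLeFun 3 κ →
    ∀ (c d : Fin (3 + 9) → Fin (3 + 9) → Fin (3 + 9) → ZMod 2),
    (∀ p j k, c p k j = c p j k) → (∀ p j k, c j p k = c p j k) → (∀ p j, c p j j = 0) →
    (∀ φ j k, d φ k j = d φ j k) → (∀ φ j k, d j φ k = d φ j k) → (∀ φ j, d φ j j = 0) →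
    (∀ φ j k, d φ j k =
      if ((((κ zeroVec ^^ κ (bxor zeroVec (fun l => decide (l = k)))) ^^
              (κ (bxor zeroVec (fun l => decide (l = j))) ^^ κ (bxor (bxor zeroVec (fun l => decide (l = j))) (fun l => decide (l = k))))) ^^
            ((κ (bxor zeroVec (fun l => decide (l = φ))) ^^ κ (bxor (bxor zeroVec (fun l => decide (l = φ))) (fun l => decide (l = k)))) ^^
              (κ (bxor (bxor zeroVec (fun l => decide (l = φ))) (fun l => decide (l = j))) ^^
                κ (bxor (bxor (bxor zeroVec (fun l => decide (l = φ))) (fun l => decide (l = j))) (fun l => decide (l = k))))))) = true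
      then 1 else 0) →
    (∀ p φ, (∑ j, ∑ k, (if j < k then c p j k * d φ j k else 0)) = if p = φ then 1 else 0) →
    (∀ y, (κ y ^^ κ (bxor y (fun l => decide (l = Fin.castAdd 9 (0 : Fin 3))))) =
      (y (Fin.castAdd 9 (1 : Fin 3)) && y (Fin.castAdd 9 (2 : Fin 3)))) →
    (∀ j k, d (Fin.castAdd 9 0) j k =
      if (j = Fin.castAdd 9 1 ∧ k = Fin.castAdd 9 2) ∨ (j = Fin.castAdd 9 2 ∧ k = Fin.castAdd 9 1) then 1 else 0) →
    #(univ.filter fun s : Fin 9 → Bool => κ (Fin.append ![false, false, false] s) = true) +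
      #(univ.filter fun s : Fin 9 → Bool => κ (Fin.append ![false, false, true] s) = true) +
      #(univ.filter fun s : Fin 9 → Bool => κ (Fin.append ![false, true, false] s) = true) < 384 →
    ∀ (i j : Bool), (i && j) = false →
    (∀ i' j' : Bool, (i' && j') = false →
      #(univ.filter fun s : Fin 9 → Bool => κ (Fin.append ![false, i, j] s) = true) ≤
        #(univ.filter fun s : Fin 9 → Bool => κ (Fin.append ![false, i', j'] s) = true)) →
    0 < #(univ.filter fun s : Fin 9 → Bool => κ (Fin.append ![false, i, j] s) = true) →
    4 * #(univ.filter fun s : Fin 9 → Bool => κ (Fin.append ![false, i, j] s) = true) + 2 ^ (9 - 1) = 2 ^ 9 →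
    ∀ (bz : Bool), (∀ s : Fin 9 → Bool, κ (Fin.append ![false, i, j] s) = true → s (Fin.castLE hk (Fin.castAdd 1 (Fin.castAdd 1 (0 : Fin 1)))) = bz) →
    (∀ u v w x : Fin 9 → Bool,
      ((((κ (Fin.append ![false, i, j] x) ^^ κ (Fin.append ![false, i, j] (bxor x w))) ^^
              (κ (Fin.append ![false, i, j] (bxor x v)) ^^ κ (Fin.append ![false, i, j] (bxor (bxor x v) w)))) ^^
            ((κ (Fin.append ![false, i, j] (bxor x u)) ^^ κ (Fin.append ![false, i, j] (bxor (bxor x u) w))) ^^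
              (κ (Fin.append ![false, i, j] (bxor (bxor x u) v)) ^^
                κ (Fin.append ![false, i, j] (bxor (bxor (bxor x u) v) w)))))) =
      ((((u (Fin.castLE hk (Fin.castAdd 1 (Fin.castAdd 1 (0 : Fin 1)))) &&
            decide ((∑ ii : Fin 1, ((if v (Fin.castLE hk (Fin.castAdd 1 (Fin.natAdd 1 ii))) = true then (1 : ZMod 2) else 0) * (if w (Fin.castLE hk (Fin.natAdd (1 + 1) ii)) = true then (1 : ZMod 2) else 0) +
              (if v (Fin.castLE hk (Fin.natAdd (1 + 1) ii)) = true then (1 : ZMod 2) else 0) * (if w (Fin.castLE hk (Fin.castAdd 1 (Fin.natAdd 1 ii))) = true then (1 : ZMod 2) else 0))) = 1)) ^^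
          (v (Fin.castLE hk (Fin.castAdd 1 (Fin.castAdd 1 (0 : Fin 1)))) &&
            decide ((∑ ii : Fin 1, ((if u (Fin.castLE hk (Fin.castAdd 1 (Fin.natAdd 1 ii))) = true then (1 : ZMod 2) else 0) * (if w (Fin.castLE hk (Fin.natAdd (1 + 1) ii)) = true then (1 : ZMod 2) else 0) +
              (if u (Fin.castLE hk (Fin.natAdd (1 + 1) ii)) = true then (1 : ZMod 2) else 0) * (if w (Fin.castLE hk (Fin.castAdd 1 (Fin.natAdd 1 ii))) = true then (1 : ZMod 2) else 0))) = 1))) ^^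
          (w (Fin.castLE hk (Fin.castAdd 1 (Fin.castAdd 1 (0 : Fin 1)))) &&
            decide ((∑ ii : Fin 1, ((if u (Fin.castLE hk (Fin.castAdd 1 (Fin.natAdd 1 ii))) = true then (1 : ZMod 2) else 0) * (if v (Fin.castLE hk (Fin.natAdd (1 + 1) ii)) = true then (1 : ZMod 2) else 0) +
              (if u (Fin.castLE hk (Fin.natAdd (1 + 1) ii)) = true then (1 : ZMod 2) else 0) * (if v (Fin.castLE hk (Fin.castAdd 1 (Fin.natAdd 1 ii))) = true then (1 : ZMod 2) else 0))) = 1))))) → i = false → j = false → False := by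
  intro hk _ κ hκ c d hcs hcc hcd hds hdc hdd hd hpair hD0 hF1 hsum i j _ _ _ hwt _ _ hT hi0 hj0
  subst hi0; subst hj0
  by_cases hle : #(univ.filter fun s : Fin 9 → Bool => κ (Fin.append ![false, true, false] s) = true) ≤
      #(univ.filter fun s : Fin 9 → Bool => κ (Fin.append ![false, false, true] s) = true)
  · exact tpw_R2_level_one_ordered hk κ hκ c d hcs hcc hcd hds hdc hdd hd hpair hD0 hF1 hsum hwt hT hle
  · -- swap `y₁ ↔ y₂`
    obtain ⟨κ', c', d', hκ'3, hcs', hcc', hcd', hd'T, hpair', hD0', hF1', hcell⟩ :=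
      tpw_R2_yframe_transport κ hκ c d hcs hcc hcd hds hdd hd hpair hD0
        (fun t t' => if (t = 0 ∧ t' = 0) ∨ (t = 1 ∧ t' = 2) ∨ (t = 2 ∧ t' = 1) then 1 else 0)
        (fun t t' => if (t = 0 ∧ t' = 0) ∨ (t = 1 ∧ t' = 2) ∨ (t = 2 ∧ t' = 1) then 1 else 0)
        (by decide) (by decide) ![false, false, false] (by decide) (by decide)
    obtain ⟨hds', hdc', hdd''⟩ := tpw_d_symm κ' d' hd'T
    have h00 : ∀ s, κ' (Fin.append ![false, false, false] s) = κ (Fin.append ![false, false, false] s) := fun s => by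
      rw [hcell]; congr 2; decide
    have h01 : ∀ s, κ' (Fin.append ![false, false, true] s) = κ (Fin.append ![false, true, false] s) := fun s => by
      rw [hcell]; congr 2; decide
    have h10 : ∀ s, κ' (Fin.append ![false, true, false] s) = κ (Fin.append ![false, false, true] s) := fun s => by
      rw [hcell]; congr 2; decide
    refine tpw_R2_level_one_ordered hk κ' hκ'3 c' d' hcs' hcc' hcd' hds' hdc' hdd'' hd'T hpair' hD0' hF1' ?_ ?_ ?_ ?_
    · simp only [h00, h01, h10]; omega
    · simp only [h00]; exact hwt
    · intro u v w x; simp only [h00]; exact hT u v w x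
    · simp only [h01, h10]; omega

end Summit.QuantumAdvantage.QuantumAdvantage.Theorems.CubicForrelation.NearExactIsExact
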